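import Summits.CriticalPhenomena.PercolationContinuityZ3.Theorems.SahiMasterFamilyPrincipalCapStep

/-!
# The vertex conjecture (V) is a theorem, every order: `F(n)` holds at every `0/1` point — for every union-closed
# family `𝒰 ∋ [n]`, the permutations all of whose cycles lie in `𝒰` have at least as many odd cycle counts as even ones

Unit `prim-masterthm-p4` (gen 14; crux anchor stmt-CriticalPhenomena-4575, helper work; memo
`run/shared/lean/prim/prim-masterthm/prim-masterthm-p4/P4-GEN14-REPORT.md` §1).  Companion of `…PrincipalCapBeta`
(`phiSet`, the conjecture-valued `PhiNonneg n` = "F(n)") and `…PrincipalCapStep` (`phiSet_nonneg_of_subfamilies`, the abstract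
step "honest sub-functionals avoiding one index `≥ 0` ⇒ `Φ ≥ 0`").

Gen 13 (P4-GEN13-REPORT §4, §6) recorded the VERTEX CONJECTURE (V) — `F(n)` restricted to the `0/1` points of its feasible set —
as OPEN beyond special cases (up-sets; `n ≤ 8` by sampling): at `β = 1_𝒰` the constraints of `F(n)` say exactly that `𝒰 ∋ univ` is
closed under unions, and `Φ_n(1_𝒰) = Σ_{σ ∈ S_n : every cycle support ∈ 𝒰} (−1)^{#cycles(σ) − 1}`.

**THEOREM (this file, every order).** `phiSet_nonneg_of_zero_one`: for every `n ≥ 1` and every `β : Finset (Fin n) → {0,1}` with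
`β univ = 1` and `β S · β T ≤ β (S ∪ T)`, `Φ_n(β) ≥ 0`.  Equivalently (`phiSet_indicator_nonneg_of_unionClosed`,
`sum_perm_sign_nonneg_of_unionClosed`): for every union-closed family `𝒰` of subsets of `Fin (n+1)` containing `univ`,
`0 ≤ Σ_{σ : all cycle supports of σ lie in 𝒰} (−1)^{#cycles(σ) − 1}`.

PROOF (five lines; the point gen 13's injections missed).  By strong induction on `n` through the abstract step
`PrincipalCapStep.phiSet_nonneg_of_subfamilies` (which needs neither supermultiplicativity nor signs): it suffices that every
honest sub-functional `Φ(β|_R)`, `R = range e ∌ last`, is `≥ 0`.  The restriction `β|_R` is again `0/1`-valued and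
supermultiplicative; if `β R = 1` it is a feasible vertex one order down (induction); if `β R = 0` then EVERY set partition of `R`
has a block of value `0` — iterated supermultiplicativity gives `∏_{B∈π} β B ≤ β(⋃ π) = β R = 0` (`prod_le_apply_biUnion_of_supermul`) —
so `Φ(β|_R) = 0` exactly (`phiSet_eq_zero_of_univ_eq_zero`, which needs only `β ≥ 0`, not `0/1`).  At vertices the
"honest sub-functionals" are therefore never negative, which is precisely what fails in the interior (memo §1: `β_i = β_ij = b`,
`β_123 = b²` gives `Φ_3 = −b²(1−b)`), so this does NOT prove `F(n)`; `PhiNonneg n` (n ≥ 8), Sahi's `C_k`, Kahn's Conjecture 5 and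
the master theorem remain OPEN.  Also recorded: the cycle form `phiSet_eq_sum_perm` of `Φ` (Lieb–Sahi's Definition 3.1 read in
the canonical signed model).  Axioms standard. [this work]
-/

noncomputable section

open scoped Classical

namespace Summit.CriticalPhenomena.PercolationContinuityZ3.Theorems

namespace PhiVertex

open Finset Function
open Literature.Combinatorics.Sahi2008
open PrincipalCapBeta (phiSet realF realW)

variable {n : ℕ}

/-! ### Iterated supermultiplicativity and the vanishing lemma -/

/-- **Iterated supermultiplicativity.**  For a nonnegative set function with `β S · β T ≤ β (S ∪ T)`, the product of the values on a
nonempty finite family of sets is at most the value on their union. [this work] -/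
theorem prod_le_apply_biUnion_of_supermul (β : Finset (Fin n) → ℝ) (h0 : ∀ B, 0 ≤ β B)
    (hsup : ∀ S T, β S * β T ≤ β (S ∪ T)) {κ : Type*} (B : κ → Finset (Fin n)) :
    ∀ J : Finset κ, J.Nonempty → ∏ j ∈ J, β (B j) ≤ β (J.biUnion B) := by
  intro J
  induction J using Finset.induction_on with
  | empty => intro h; exact absurd h Finset.not_nonempty_empty
  | insert a s ha ih =>
    intro _
    rw [prod_insert ha, Finset.biUnion_insert]
    by_cases hs : s.Nonempty
    · calc β (B a) * ∏ j ∈ s, β (B j) ≤ β (B a) * β (s.biUnion B) :=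
            mul_le_mul_of_nonneg_left (ih hs) (h0 _)
        _ ≤ β (B a ∪ s.biUnion B) := hsup _ _
    · rw [not_nonempty_iff_eq_empty.1 hs, prod_empty, Finset.biUnion_empty, union_empty, mul_one]

/-- The blocks of a set partition cover the ground set. [folklore] -/
theorem biUnion_block_eq_univ (c : OrderedFinpartition n) : univ.biUnion (PartitionForm.block c) = univ := by
  ext x
  simp only [mem_biUnion, mem_univ, true_and, iff_true]
  refine ⟨c.index x, ?_⟩
  unfold PartitionForm.block
  exact mem_filter.2 ⟨mem_univ _, rfl⟩

/-- **Vanishing lemma.**  If `β ≥ 0` is supermultiplicative and its top value is `0`, then every set partition has a block of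
value `0`, so `Φ_{n+1}(β) = 0`. [this work] -/
theorem phiSet_eq_zero_of_univ_eq_zero (β : Finset (Fin (n + 1)) → ℝ) (h0 : ∀ B, 0 ≤ β B)
    (hsup : ∀ S T, β S * β T ≤ β (S ∪ T)) (htop : β univ = 0) : phiSet (n + 1) β = 0 := by
  unfold PrincipalCapBeta.phiSet
  refine sum_eq_zero fun c _ => ?_
  have hne : (univ : Finset (Fin c.length)).Nonempty := ⟨c.index 0, mem_univ _⟩
  have hle : ∏ j, β (PartitionForm.block c j) ≤ β univ := by
    have h := prod_le_apply_biUnion_of_supermul β h0 hsup (PartitionForm.block c) univ hne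
    rwa [biUnion_block_eq_univ] at h
  have hge : 0 ≤ ∏ j, β (PartitionForm.block c j) := prod_nonneg fun j _ => h0 _
  have hz : ∏ j, β (PartitionForm.block c j) = 0 := le_antisymm (htop ▸ hle) hge
  rw [prod_mul_distrib, hz, mul_zero, mul_zero]

/-! ### (V): `F(n)` at every vertex, every order -/

/-- An embedding `Fin (m+1) ↪ Fin (k+1)` missing the last index has `m < k`. [folklore] -/
theorem lt_of_emb_ne_last {m k : ℕ} (e : Fin (m + 1) ↪ Fin (k + 1)) (he : ∀ j, e j ≠ Fin.last k) : m < k := by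
  have hcard : (univ.map e).card = m + 1 := by rw [card_map, card_univ, Fintype.card_fin]
  have hsub : univ.map e ⊆ univ.erase (Fin.last k) := fun x hx => by
    rw [mem_erase]
    obtain ⟨j, _, rfl⟩ := mem_map.1 hx
    exact ⟨he j, mem_univ _⟩
  have h := card_le_card hsub
  rw [hcard, card_erase_of_mem (mem_univ _), card_univ, Fintype.card_fin] at h
  omega

/-- **THEOREM (V), every order.**  For every `0/1`-valued set function `β` on `Finset (Fin (k+1))` with `β univ = 1` and
`β S · β T ≤ β (S ∪ T)` for all `S, T`:  `0 ≤ Φ_{k+1}(β)`.  (`F(k+1)` at the vertices of its feasible set.) [this work] -/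
theorem phiSet_nonneg_of_zero_one : ∀ (k : ℕ) (β : Finset (Fin (k + 1)) → ℝ), (∀ B, β B = 0 ∨ β B = 1) →
    β univ = 1 → (∀ S T, β S * β T ≤ β (S ∪ T)) → 0 ≤ phiSet (k + 1) β := by
  intro k
  induction k using Nat.strong_induction_on with
  | _ k ih =>
  intro β h01 huniv hsup
  have h0 : ∀ B, 0 ≤ β B := fun B => by rcases h01 B with h | h <;> simp [h]
  have h1 : ∀ B, β B ≤ 1 := fun B => by rcases h01 B with h | h <;> simp [h]
  refine PrincipalCapStep.phiSet_nonneg_of_subfamilies β h1 huniv fun m e he => ?_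
  have h01' : ∀ B : Finset (Fin (m + 1)), β (B.map e) = 0 ∨ β (B.map e) = 1 := fun B => h01 _
  have h0' : ∀ B : Finset (Fin (m + 1)), 0 ≤ β (B.map e) := fun B => h0 _
  have hsup' : ∀ S T : Finset (Fin (m + 1)), β (S.map e) * β (T.map e) ≤ β ((S ∪ T).map e) := fun S T => by
    rw [Finset.map_union]; exact hsup _ _
  rcases h01' univ with hz | ho
  · exact le_of_eq (phiSet_eq_zero_of_univ_eq_zero (fun S => β (S.map e)) h0' hsup' hz).symm
  · exact ih m (lt_of_emb_ne_last e he) (fun S => β (S.map e)) h01' ho hsup'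

/-- The same for every order `n ≥ 1`. [this work] -/
theorem phiSet_nonneg_of_zero_one' (hn : 1 ≤ n) (β : Finset (Fin n) → ℝ) (h01 : ∀ B, β B = 0 ∨ β B = 1)
    (huniv : β univ = 1) (hsup : ∀ S T, β S * β T ≤ β (S ∪ T)) : 0 ≤ phiSet n β := by
  obtain ⟨k, rfl⟩ := Nat.exists_eq_add_of_le' hn
  exact phiSet_nonneg_of_zero_one k β h01 huniv hsup

/-- **`PhiNonneg n` holds at every vertex** (`0/1` point) of its feasible set, every `n`. [this work] -/
theorem phiNonneg_vertex (n : ℕ) (β : Finset (Fin n) → ℝ) (h01 : ∀ B, β B = 0 ∨ β B = 1) (huniv : β univ = 1)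
    (hsup : ∀ S T, β S * β T ≤ β (S ∪ T)) : 0 ≤ phiSet n β := by
  rcases Nat.eq_zero_or_pos n with rfl | hn
  · unfold PrincipalCapBeta.phiSet
    refine sum_nonneg fun c _ => ?_
    have hl : c.length = 0 := by
      by_contra h
      obtain ⟨l, hl⟩ : ∃ l : ℕ, c.length = l + 1 := Nat.exists_eq_succ_of_ne_zero h
      have j : Fin c.length := Fin.cast hl.symm 0
      exact Fin.elim0 (c.emb j (Fin.cast (by simp) (⟨0, c.partSize_pos j⟩ : Fin (c.partSize j))))
    have hprod : ∏ j : Fin c.length, (((c.partSize j - 1).factorial : ℝ) * β (PartitionForm.block c j)) = 1 := by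
      haveI : IsEmpty (Fin c.length) := by rw [hl]; infer_instance
      rw [Finset.univ_eq_empty, prod_empty]
    rw [hprod, mul_one, hl]
    norm_num
  · exact phiSet_nonneg_of_zero_one' hn β h01 huniv hsup

/-! ### The union-closed-family form and the cycle form -/

/-- **(V) for union-closed families.**  If `𝒰` is a family of subsets of `Fin n` (`n ≥ 1`) closed under unions and containing
`univ`, then `Φ_n(1_𝒰) ≥ 0`. [this work] -/
theorem phiSet_indicator_nonneg_of_unionClosed (hn : 1 ≤ n) (𝒰 : Finset (Finset (Fin n)))
    (hU : ∀ A ∈ 𝒰, ∀ B ∈ 𝒰, A ∪ B ∈ 𝒰) (htop : univ ∈ 𝒰) :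
    0 ≤ phiSet n (fun S => if S ∈ 𝒰 then 1 else 0) := by
  refine phiSet_nonneg_of_zero_one' hn _ (fun B => ?_) (if_pos htop) (fun S T => ?_)
  · by_cases h : B ∈ 𝒰
    · exact Or.inr (if_pos h)
    · exact Or.inl (if_neg h)
  · by_cases hS : S ∈ 𝒰
    · by_cases hT : T ∈ 𝒰
      · rw [if_pos hS, if_pos hT, if_pos (hU S hS T hT), mul_one]
      · rw [if_neg hT, mul_zero]; split_ifs <;> norm_num
    · rw [if_neg hS, zero_mul]; split_ifs <;> norm_num

/-- **Cycle form of `Φ`** (Lieb–Sahi's Definition 3.1 in the canonical signed model `realW β`):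
`Φ_{n+1}(β) = Σ_{σ ∈ S_{n+1}} (−1)^{#cycles(σ) − 1} ∏_{c ∈ cycles(σ)} β(c)`. [this work] -/
theorem phiSet_eq_sum_perm (β : Finset (Fin (n + 1)) → ℝ) :
    phiSet (n + 1) β = ∑ σ : Equiv.Perm (Fin (n + 1)),
      (-1 : ℝ) ^ ((CycleForm.orbits σ).card - 1) * ∏ B ∈ CycleForm.orbits σ, β B := by
  rw [PrincipalCapBeta.phiSet_eq_sahiE_real, sahiE_eq_sahiECycle _ _ (Nat.succ_le_succ (Nat.zero_le n))]
  unfold sahiECycle CycleForm.cycleE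
  refine sum_congr rfl fun σ _ => ?_
  congr 1
  refine prod_congr rfl fun B _ => ?_
  have e1 : (fun x => ∏ i ∈ B, realF i x) = ∏ i ∈ B, (realF i : Finset (Fin (n + 1)) → ℝ) :=
    funext fun x => (Finset.prod_apply x B _).symm
  rw [e1, PrincipalCapBeta.ex_realW_prod]

/-- **(V) in cycle form.**  For a union-closed family `𝒰` of subsets of `Fin (n+1)` containing `univ`:
`0 ≤ Σ_{σ ∈ S_{n+1} : every cycle support of σ lies in 𝒰} (−1)^{#cycles(σ) − 1}` — among the permutations all of whose cycles
lie in `𝒰`, those with an odd number of cycles are at least as many as those with an even number. [this work] -/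
theorem sum_perm_sign_nonneg_of_unionClosed (𝒰 : Finset (Finset (Fin (n + 1))))
    (hU : ∀ A ∈ 𝒰, ∀ B ∈ 𝒰, A ∪ B ∈ 𝒰) (htop : univ ∈ 𝒰) :
    0 ≤ ∑ σ ∈ (univ : Finset (Equiv.Perm (Fin (n + 1)))).filter (fun σ => ∀ B ∈ CycleForm.orbits σ, B ∈ 𝒰),
      (-1 : ℝ) ^ ((CycleForm.orbits σ).card - 1) := by
  have h := phiSet_indicator_nonneg_of_unionClosed (Nat.succ_le_succ (Nat.zero_le n)) 𝒰 hU htop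
  rw [phiSet_eq_sum_perm, ← sum_filter_add_sum_filter_not univ (fun σ => ∀ B ∈ CycleForm.orbits σ, B ∈ 𝒰)] at h
  have hin : ∀ σ ∈ univ.filter (fun σ : Equiv.Perm (Fin (n + 1)) => ∀ B ∈ CycleForm.orbits σ, B ∈ 𝒰),
      (-1 : ℝ) ^ ((CycleForm.orbits σ).card - 1) * ∏ B ∈ CycleForm.orbits σ, (if B ∈ 𝒰 then (1 : ℝ) else 0) =
        (-1 : ℝ) ^ ((CycleForm.orbits σ).card - 1) := by
    intro σ hσ
    rw [prod_eq_one fun B hB => if_pos ((mem_filter.1 hσ).2 B hB), mul_one]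
  have hout : ∀ σ ∈ univ.filter (fun σ : Equiv.Perm (Fin (n + 1)) => ¬ ∀ B ∈ CycleForm.orbits σ, B ∈ 𝒰),
      (-1 : ℝ) ^ ((CycleForm.orbits σ).card - 1) * ∏ B ∈ CycleForm.orbits σ, (if B ∈ 𝒰 then (1 : ℝ) else 0) = 0 := by
    intro σ hσ
    have hex : ∃ B ∈ CycleForm.orbits σ, B ∉ 𝒰 := by
      have h2 := (mem_filter.1 hσ).2
      push Not at h2
      exact h2
    obtain ⟨B, hB, hBU⟩ := hex
    rw [prod_eq_zero hB (if_neg hBU), mul_zero]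
  rw [sum_congr rfl hin, sum_congr rfl hout, sum_const_zero, add_zero] at h
  exact h

end PhiVertex

end Summit.CriticalPhenomena.PercolationContinuityZ3.Theorems
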